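import Summits.Parity.BatemanHorn.Theorems.SelbergDelangeRigidityLSDRealSegmentTailsPeeledAux
import Summits.Parity.BatemanHorn.Theorems.SelbergDelangeRigidityLSDRealSegmentTailsAux2
import HarnessLib

/-!
# Route `SelbergDelangeRigidity`, crux `LSDRealSegment` (stmt-Parity-9770), line
# `product-anatomy-subcritical`: the harmonic factors of the restoration engine (`stub_tailsTwo`, clauses (b)–(d))

The right-hand side of Nair–Tenenbaum along a Bateman–Horn system carries, per member, the harmonic factor
`H(N) = Σ_{m ≤ N} G(m) ρⱼ(m)/m` of the weight `G`.  `tailsTwo_harmonic` (registered helper) evaluates it for EVERY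
non-negative multiplicative `G` with `G(p^ν) ≤ (y p^{(2−y)/8})^ν` (so that the `p = 2` factor converges: `y < 2`) in
terms of the prime sum: if `Σ_{p ≤ N} G(p)ρⱼ(p)/p ≤ y Σ_{p ≤ W} ρⱼ(p)/p + K` then `H(N) ≤ C e^K (log W)^y`
(Hall–Tenenbaum (0.4), Mertens, and the PROVED convergence of `Σ (1 − ρⱼ(p))/p`).  Instances: the `w`-SMOOTH tilt
`y^{Ω} 1_{w-smooth}` (`W = w`, `K = 0`: the factor `(log w)^y = (η log x)^y` of the top and balanced classes) and the
RANKIN tilt `y^{Ω} (smoothPart z ·)^σ` (`W = N`, `K = O(1)` uniformly in `z`, `σ ≤ min((2−y)/8, 1/log z)`).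
-/

open Filter Finset Polynomial
open scoped BigOperators Topology Classical

namespace Summit.Parity.BatemanHorn.Cruxes.LSDRealSegment.ProductAnatomySubcritical

open Literature.NumberTheory.Sieve
open ArithmeticFunction (cardFactors)
noncomputable section

variable {k : ℕ}

/-! ### The general harmonic lemma for one member -/

/-- The general harmonic lemma for a one-polynomial Bateman–Horn system `![g]`. [folklore] -/
-- adapted from `exists_harmonic_rootCount_le_single` (`…TailsPeeledAux`)
theorem harmonic_general_single {g : ℤ[X]} (hg : IsBatemanHornSystem ![g]) {y : ℝ} (hy : 1 ≤ y) (hy2 : y < 2) :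
    ∃ C : ℝ, 0 < C ∧ ∀ (G : ℕ → ℝ) (N W : ℕ) (K : ℝ), 2 ≤ W → (∀ m, 0 ≤ G m) → G 1 = 1 →
      (∀ m n : ℕ, m.Coprime n → G (m * n) = G m * G n) →
      (∀ p : ℕ, p.Prime → ∀ ν : ℕ, G (p ^ ν) ≤ (y * (p : ℝ) ^ ((2 - y) / 8)) ^ ν) →
      (∑ p ∈ Nat.primesLE N, G p * (polyRootCountMod ![g] p : ℝ) / p ≤
        y * (∑ p ∈ Nat.primesLE W, (polyRootCountMod ![g] p : ℝ) / p) + K) →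
      ∑ m ∈ Icc 1 N, G m * (polyRootCountMod ![g] m : ℝ) / m ≤ C * Real.exp K * Real.log W ^ y := by
  have hy0 : 0 ≤ y := by linarith
  obtain ⟨Cρ, hCρ⟩ := exists_polyRootCountMod_prime_pow_le_of_system hg
  obtain ⟨L, hL⟩ := AZFG2020_tendsto_sum_sub_omega_div_holds 1 ![g] hg
  obtain ⟨b, hb⟩ := hL.bddBelow_range
  have hlow : ∀ x : ℕ, b ≤ ∑ p ∈ Nat.primesLE x, (((1 : ℕ) : ℝ) - polyRootCountMod ![g] p) / p :=
    fun x => hb ⟨x, rfl⟩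
  set r₀ : ℝ := y * (2 : ℝ) ^ ((2 - y) / 8 - 1) with hr₀
  have hr1 : r₀ < 1 := r0_lt_one hy hy2
  have hr00 : 0 ≤ r₀ := by rw [hr₀]; positivity
  set S : ℝ := ∑' n : ℕ, (n : ℝ) ^ (-(3 / 2 : ℝ)) with hS
  have hS0 : 0 ≤ S := tsum_nonneg fun n => Real.rpow_nonneg (Nat.cast_nonneg n) _
  set C₁ : ℝ := Cρ * (4 * S) / (1 - r₀) with hC₁
  have hC₁0 : 0 ≤ C₁ := by rw [hC₁]; exact div_nonneg (by positivity) (by linarith)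
  refine ⟨Real.exp (4 * y - y * b + C₁), Real.exp_pos _, ?_⟩
  intro G N W K hW hG0 hG1 hGmul hGp hsum
  -- the multiplicative weight `w(m) = G(m) ρ(m)`
  set w : ℕ → ℝ := fun m => G m * (polyRootCountMod ![g] m : ℝ) with hw
  have hw0 : ∀ m, 0 ≤ w m := fun m => by simp only [hw]; exact mul_nonneg (hG0 m) (Nat.cast_nonneg _)
  have hw1 : w 1 = 1 := by simp [hw, hG1, polyRootCountMod_one]
  have hwmul : ∀ m n : ℕ, m.Coprime n → w (m * n) = w m * w n := by
    intro m n hmn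
    simp only [hw]
    rw [hGmul m n hmn, polyRootCountMod_mul_of_coprime_system _ hmn, Nat.cast_mul]
    ring
  -- local terms: `w(p^ν)/p^ν ≤ Cρ u_p^ν`, `u_p = y p^{σ₀−1} ≤ r₀`
  have hu : ∀ p : ℕ, p.Prime → 0 ≤ y * (p : ℝ) ^ ((2 - y) / 8 - 1) ∧ y * (p : ℝ) ^ ((2 - y) / 8 - 1) ≤ r₀ :=
    fun p hp => ⟨by positivity, mul_rpow_prime_le_two hy0 (by linarith) hp⟩
  have hloc : ∀ p : ℕ, p.Prime → ∀ ν : ℕ, w (p ^ ν) / (p : ℝ) ^ ν ≤ Cρ * (y * (p : ℝ) ^ ((2 - y) / 8 - 1)) ^ ν := by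
    intro p hp ν
    have hp0 : (0 : ℝ) < p := by exact_mod_cast hp.pos
    simp only [hw]
    have h1 : (polyRootCountMod ![g] (p ^ ν) : ℝ) ≤ Cρ := by exact_mod_cast hCρ p hp ν
    have h2 : G (p ^ ν) / (p : ℝ) ^ ν ≤ (y * (p : ℝ) ^ ((2 - y) / 8 - 1)) ^ ν := by
      rw [div_le_iff₀ (by positivity)]
      calc G (p ^ ν) ≤ (y * (p : ℝ) ^ ((2 - y) / 8)) ^ ν := hGp p hp ν
        _ = (y * (p : ℝ) ^ ((2 - y) / 8 - 1)) ^ ν * (p : ℝ) ^ ν := by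
            rw [← mul_pow, Real.rpow_sub_one hp0.ne']
            congr 1
            field_simp
    calc G (p ^ ν) * (polyRootCountMod ![g] (p ^ ν) : ℝ) / (p : ℝ) ^ ν = (G (p ^ ν) / (p : ℝ) ^ ν) * polyRootCountMod ![g] (p ^ ν) := by
          ring
      _ ≤ (y * (p : ℝ) ^ ((2 - y) / 8 - 1)) ^ ν * Cρ := mul_le_mul h2 h1 (Nat.cast_nonneg _) (by positivity)
      _ = _ := mul_comm _ _
  have hsumm : ∀ p : ℕ, p.Prime → Summable (fun ν : ℕ => w (p ^ ν) / (p : ℝ) ^ ν) := by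
    intro p hp
    obtain ⟨h0, h1⟩ := hu p hp
    exact Summable.of_nonneg_of_le (fun ν => div_nonneg (hw0 _) (by positivity)) (hloc p hp)
      ((summable_geometric_of_lt_one h0 (h1.trans_lt hr1)).mul_left (Cρ : ℝ))
  -- local factors `≤ exp(G(p)ρ(p)/p + Cρ u_p²/(1 − r₀))`
  have hfac : ∀ p : ℕ, p.Prime → ∑' ν : ℕ, w (p ^ ν) / (p : ℝ) ^ ν ≤
      Real.exp (G p * (polyRootCountMod ![g] p : ℝ) / p + Cρ * (y * (p : ℝ) ^ ((2 - y) / 8 - 1)) ^ 2 / (1 - r₀)) := by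
    intro p hp
    obtain ⟨h0, h1⟩ := hu p hp
    set u := y * (p : ℝ) ^ ((2 - y) / 8 - 1) with hudef
    have hu1 : u < 1 := h1.trans_lt hr1
    have hs := hsumm p hp
    rw [hs.tsum_eq_zero_add, ((summable_nat_add_iff 1).mpr hs).tsum_eq_zero_add]
    simp only [pow_zero, hw1, div_one, zero_add, pow_one]
    have hwp : w p / p = G p * (polyRootCountMod ![g] p : ℝ) / p := by simp only [hw]
    have htail : ∑' ν : ℕ, w (p ^ (ν + 1 + 1)) / (p : ℝ) ^ (ν + 1 + 1) ≤ Cρ * u ^ 2 / (1 - r₀) := by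
      have hle2 : ∀ ν : ℕ, w (p ^ (ν + 1 + 1)) / (p : ℝ) ^ (ν + 1 + 1) ≤ Cρ * u ^ 2 * u ^ ν := by
        intro ν
        calc _ ≤ Cρ * u ^ (ν + 1 + 1) := hloc p hp _
          _ = Cρ * u ^ 2 * u ^ ν := by ring
      have hg2 : Summable (fun ν : ℕ => Cρ * u ^ 2 * u ^ ν) := (summable_geometric_of_lt_one h0 hu1).mul_left _
      calc ∑' ν : ℕ, w (p ^ (ν + 1 + 1)) / (p : ℝ) ^ (ν + 1 + 1) ≤ ∑' ν : ℕ, Cρ * u ^ 2 * u ^ ν :=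
            ((summable_nat_add_iff 2).mpr hs).tsum_le_tsum hle2 hg2
        _ = Cρ * u ^ 2 * (1 - u)⁻¹ := by rw [tsum_mul_left, tsum_geometric_of_lt_one h0 hu1]
        _ ≤ Cρ * u ^ 2 * (1 - r₀)⁻¹ := by
            refine mul_le_mul_of_nonneg_left ?_ (by positivity)
            rw [inv_le_inv₀ (by linarith) (by linarith)]
            linarith
        _ = Cρ * u ^ 2 / (1 - r₀) := by rw [div_eq_mul_inv]
    rw [hwp]
    have := Real.add_one_le_exp (G p * (polyRootCountMod ![g] p : ℝ) / p + Cρ * u ^ 2 / (1 - r₀))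
    linarith
  -- the sum of the exponents over `p ≤ N`
  have hexp : ∑ p ∈ Nat.primesLE N, (G p * (polyRootCountMod ![g] p : ℝ) / p + Cρ * (y * (p : ℝ) ^ ((2 - y) / 8 - 1)) ^ 2 / (1 - r₀))
      ≤ y * Real.log (Real.log W) + (4 * y - y * b + C₁) + K := by
    rw [Finset.sum_add_distrib]
    -- the quadratic terms
    have hQ : ∑ p ∈ Nat.primesLE N, Cρ * (y * (p : ℝ) ^ ((2 - y) / 8 - 1)) ^ 2 / (1 - r₀) ≤ C₁ := by
      rw [← Finset.sum_div, ← Finset.mul_sum, hC₁]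
      refine div_le_div_of_nonneg_right (mul_le_mul_of_nonneg_left ?_ (Nat.cast_nonneg _)) (by linarith)
      calc ∑ p ∈ Nat.primesLE N, (y * (p : ℝ) ^ ((2 - y) / 8 - 1)) ^ 2 ≤ ∑ p ∈ Nat.primesLE N, 4 * (p : ℝ) ^ (-(3 / 2 : ℝ)) :=
            Finset.sum_le_sum fun p hp => rp_sq_le hy0 hy2.le (by linarith) (Nat.prime_of_mem_primesLE hp)
        _ = 4 * ∑ p ∈ Nat.primesLE N, (p : ℝ) ^ (-(3 / 2 : ℝ)) := by rw [Finset.mul_sum]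
        _ ≤ 4 * S := by
            gcongr
            exact (Real.summable_nat_rpow.mpr (by norm_num)).sum_le_tsum _ fun n _ => Real.rpow_nonneg (Nat.cast_nonneg n) _
    -- the prime sum: `Σ_{p ≤ W} ρ(p)/p = Σ 1/p − Σ (1 − ρ(p))/p ≤ log log W + 4 − b`
    have hρ : ∑ p ∈ Nat.primesLE W, (polyRootCountMod ![g] p : ℝ) / p =
        (∑ p ∈ Nat.primesLE W, (1 : ℝ) / p) - ∑ p ∈ Nat.primesLE W, (((1 : ℕ) : ℝ) - polyRootCountMod ![g] p) / p := by
      rw [← Finset.sum_sub_distrib]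
      refine Finset.sum_congr rfl fun p _ => ?_
      push_cast
      ring
    have hA := Literature.NumberTheory.LFunctions.MertensBound.sum_inv_prime_le W hW
    have hB := hlow W
    have hP : ∑ p ∈ Nat.primesLE W, (polyRootCountMod ![g] p : ℝ) / p ≤ Real.log (Real.log W) + 4 - b := by
      rw [hρ]; linarith
    nlinarith [mul_le_mul_of_nonneg_left hP hy0]
  -- assemble
  have h04 := Literature.NumberTheory.LFunctions.HallTenenbaum.sum_div_le_prod_tsum hw1 hwmul hw0 hsumm N
  have e : ∑ m ∈ Icc 1 N, G m * (polyRootCountMod ![g] m : ℝ) / m = ∑ m ∈ Icc 1 N, w m / m :=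
    Finset.sum_congr rfl fun m _ => by simp only [hw]
  rw [e]
  have hlogW : 0 < Real.log W := Real.log_pos (by exact_mod_cast hW)
  calc ∑ m ∈ Icc 1 N, w m / m ≤ ∏ p ∈ Nat.primesLE N, ∑' ν : ℕ, w (p ^ ν) / (p : ℝ) ^ ν := h04
    _ ≤ ∏ p ∈ Nat.primesLE N, Real.exp (G p * (polyRootCountMod ![g] p : ℝ) / p +
          Cρ * (y * (p : ℝ) ^ ((2 - y) / 8 - 1)) ^ 2 / (1 - r₀)) :=
        Finset.prod_le_prod (fun p _ => tsum_nonneg fun ν => div_nonneg (hw0 _) (by positivity))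
          fun p hp => hfac p (Nat.prime_of_mem_primesLE hp)
    _ = Real.exp (∑ p ∈ Nat.primesLE N, (G p * (polyRootCountMod ![g] p : ℝ) / p +
          Cρ * (y * (p : ℝ) ^ ((2 - y) / 8 - 1)) ^ 2 / (1 - r₀))) := by rw [Real.exp_sum]
    _ ≤ Real.exp (y * Real.log (Real.log W) + (4 * y - y * b + C₁) + K) := Real.exp_le_exp.mpr hexp
    _ = Real.exp (4 * y - y * b + C₁) * Real.exp K * Real.log W ^ y := by
        rw [Real.rpow_def_of_pos hlogW, ← Real.exp_add, ← Real.exp_add]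
        congr 1
        ring

/-- **tailsTwo_harmonic** (registered helper of `stub_tailsTwo`, line `product-anatomy-subcritical`): the general
harmonic lemma along a Bateman–Horn system — for every member `j`, every non-negative multiplicative weight `G` with
`G(1) = 1`, `G(p^ν) ≤ (y p^{(2−y)/8})^ν`, and `Σ_{p ≤ N} G(p)ρⱼ(p)/p ≤ y Σ_{p ≤ W} ρⱼ(p)/p + K` (`W ≥ 2`):
`Σ_{m ≤ N} G(m) ρⱼ(m)/m ≤ C e^K (log W)^y`, one `C = C(f, y)` for all `j, G, N, W, K`. [folklore] -/
theorem tailsTwo_harmonic : ∀ (k : ℕ) (f : Fin k → ℤ[X]), IsBatemanHornSystem f → ∀ y : ℝ, 1 ≤ y → y < 2 →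
    ∃ C : ℝ, 0 < C ∧ ∀ (j : Fin k) (G : ℕ → ℝ) (N W : ℕ) (K : ℝ), 2 ≤ W → (∀ m, 0 ≤ G m) → G 1 = 1 →
      (∀ m n : ℕ, m.Coprime n → G (m * n) = G m * G n) →
      (∀ p : ℕ, p.Prime → ∀ ν : ℕ, G (p ^ ν) ≤ (y * (p : ℝ) ^ ((2 - y) / 8)) ^ ν) →
      (∑ p ∈ Nat.primesLE N, G p * (polyRootCountMod ![f j] p : ℝ) / p ≤
        y * (∑ p ∈ Nat.primesLE W, (polyRootCountMod ![f j] p : ℝ) / p) + K) →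
      ∑ m ∈ Icc 1 N, G m * (polyRootCountMod ![f j] m : ℝ) / m ≤ C * Real.exp K * Real.log W ^ y := by
  intro k f hf y hy hy2
  choose C hC0 hC using fun j : Fin k => harmonic_general_single (BatemanHornMertens.isBatemanHornSystem_single hf j) hy hy2
  refine ⟨1 + ∑ j, C j, add_pos_of_pos_of_nonneg one_pos (Finset.sum_nonneg fun i _ => (hC0 i).le),
    fun j G N W K hW hG0 hG1 hGmul hGp hsum => ?_⟩
  refine (hC j G N W K hW hG0 hG1 hGmul hGp hsum).trans ?_
  have h1 : C j ≤ 1 + ∑ j, C j := by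
    have := Finset.single_le_sum (f := C) (fun i _ => (hC0 i).le) (Finset.mem_univ j)
    linarith
  have h2 : 0 ≤ Real.exp K * Real.log W ^ y := mul_nonneg (Real.exp_pos K).le (Real.rpow_nonneg (Real.log_natCast_nonneg W) y)
  nlinarith

/-! ### Instance: the `w`-smooth tilt -/

/-- **The smooth harmonic factor**: `Σ_{m ≤ N, m w-smooth} y^{Ω(m)} ρⱼ(m)/m ≤ C (log w)^y` for `w ≥ 2`, uniformly
(`G = y^{Ω} 1_{w-smooth}`, `W = w`, `K = 0`). [folklore] -/
theorem harmonic_smooth {f : Fin k → ℤ[X]} (hf : IsBatemanHornSystem f) {y : ℝ} (hy : 1 ≤ y) (hy2 : y < 2) :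
    ∃ C : ℝ, 0 < C ∧ ∀ (j : Fin k) (N w : ℕ), 2 ≤ w →
      ∑ m ∈ (Icc 1 N).filter (fun m : ℕ => ∀ p ∈ m.primeFactors, p ≤ w),
        y ^ cardFactors m * (polyRootCountMod ![f j] m : ℝ) / m ≤ C * Real.log w ^ y := by
  obtain ⟨C, hC0, hC⟩ := tailsTwo_harmonic k f hf y hy hy2
  have hy0 : 0 ≤ y := by linarith
  refine ⟨C, hC0, fun j N w hw => ?_⟩
  set G : ℕ → ℝ := fun m => if ∀ p ∈ m.primeFactors, p ≤ w then y ^ cardFactors m else 0 with hG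
  have hG0 : ∀ m, 0 ≤ G m := fun m => by simp only [hG]; split_ifs <;> positivity
  have hG1 : G 1 = 1 := by
    simp only [hG]
    rw [if_pos (fun p hp => by simp [Nat.primeFactors_one] at hp), ArithmeticFunction.cardFactors_one, pow_zero]
  have hGmul : ∀ m n : ℕ, m.Coprime n → G (m * n) = G m * G n := by
    intro m n hmn
    rcases eq_or_ne m 0 with rfl | hm
    · obtain rfl : n = 1 := by simpa using hmn
      simp [hG1]
    rcases eq_or_ne n 0 with rfl | hn
    · obtain rfl : m = 1 := by simpa using hmn
      simp [hG1]
    simp only [hG, Nat.primeFactors_mul hm hn, Finset.mem_union]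
    by_cases h1 : ∀ p ∈ m.primeFactors, p ≤ w
    · by_cases h2 : ∀ p ∈ n.primeFactors, p ≤ w
      · rw [if_pos (fun p hp => hp.elim (h1 p) (h2 p)), if_pos h1, if_pos h2, ArithmeticFunction.cardFactors_mul hm hn, pow_add]
      · rw [if_neg (fun h => h2 fun p hp => h p (Or.inr hp)), if_neg h2, mul_zero]
    · rw [if_neg (fun h => h1 fun p hp => h p (Or.inl hp)), if_neg h1, zero_mul]
  have hGp : ∀ p : ℕ, p.Prime → ∀ ν : ℕ, G (p ^ ν) ≤ (y * (p : ℝ) ^ ((2 - y) / 8)) ^ ν := by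
    intro p hp ν
    have h1 : y ^ ν ≤ (y * (p : ℝ) ^ ((2 - y) / 8)) ^ ν := by
      refine pow_le_pow_left₀ hy0 ?_ ν
      have : (1 : ℝ) ≤ (p : ℝ) ^ ((2 - y) / 8) := Real.one_le_rpow (by exact_mod_cast hp.one_lt.le) (by linarith)
      nlinarith
    simp only [hG]
    split_ifs
    · rw [ArithmeticFunction.cardFactors_apply_prime_pow hp]; exact h1
    · positivity
  have hsum : ∑ p ∈ Nat.primesLE N, G p * (polyRootCountMod ![f j] p : ℝ) / p ≤
      y * (∑ p ∈ Nat.primesLE w, (polyRootCountMod ![f j] p : ℝ) / p) + 0 := by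
    rw [add_zero, Finset.mul_sum]
    have e : ∀ p ∈ Nat.primesLE N, G p * (polyRootCountMod ![f j] p : ℝ) / p =
        if p ≤ w then y * ((polyRootCountMod ![f j] p : ℝ) / p) else 0 := by
      intro p hp
      have hp' := Nat.prime_of_mem_primesLE hp
      simp only [hG, hp'.primeFactors, Finset.mem_singleton, forall_eq, ArithmeticFunction.cardFactors_apply_prime hp',
        pow_one]
      split_ifs <;> ring
    rw [Finset.sum_congr rfl e, ← Finset.sum_filter]
    refine Finset.sum_le_sum_of_subset_of_nonneg (fun p hp => ?_) fun p _ _ => by positivity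
    rw [Finset.mem_filter, Nat.mem_primesLE] at hp
    exact Nat.mem_primesLE.mpr ⟨hp.2, hp.1.2⟩
  have h := hC j G N w 0 hw hG0 hG1 hGmul hGp hsum
  rw [Real.exp_zero, mul_one] at h
  refine le_trans (le_of_eq ?_) h
  rw [Finset.sum_filter]
  refine Finset.sum_congr rfl fun m _ => ?_
  simp only [hG]
  split_ifs <;> simp

/-! ### Instance: the Rankin tilt -/

/-- **The Rankin harmonic factor**: `Σ_{m ≤ N} y^{Ω(m)} (smoothPart z m)^σ ρⱼ(m)/m ≤ C (log N)^y` for `N ≥ 2`, uniformly in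
`z ≥ 1` and `0 ≤ σ ≤ min((2−y)/8, 1/log z)` (`G(p) = y p^σ ≤ y(1 + 2σ log p)` on `p ≤ z`: `K = O(1)` by Mertens). [folklore] -/
theorem harmonic_rankin {f : Fin k → ℤ[X]} (hf : IsBatemanHornSystem f) {y : ℝ} (hy : 1 ≤ y) (hy2 : y < 2) :
    ∃ C : ℝ, 0 < C ∧ ∀ (j : Fin k) (N : ℕ) (z σ : ℝ), 2 ≤ N → 1 ≤ z → 0 ≤ σ → σ ≤ (2 - y) / 8 → σ * Real.log z ≤ 1 →
      ∑ m ∈ Icc 1 N, y ^ cardFactors m * (smoothPart z m : ℝ) ^ σ * (polyRootCountMod ![f j] m : ℝ) / m ≤ C * Real.log N ^ y := by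
  obtain ⟨C, hC0, hC⟩ := tailsTwo_harmonic k f hf y hy hy2
  obtain ⟨Cρ, hCρ⟩ := exists_polyRootCountMod_prime_pow_le_of_system hf
  have hy0 : 0 ≤ y := by linarith
  set K : ℝ := 2 * y * Cρ * 4 with hK
  refine ⟨C * Real.exp K, by positivity, fun j N z σ hN hz hσ hσ₀ hσz => ?_⟩
  set G : ℕ → ℝ := fun m => y ^ cardFactors m * (smoothPart z m : ℝ) ^ σ with hG
  have hGdef : ∀ m, G m = y ^ cardFactors m * (smoothPart z m : ℝ) ^ σ := fun _ => rfl
  have hGp : ∀ p : ℕ, p.Prime → ∀ ν : ℕ, G (p ^ ν) ≤ (y * (p : ℝ) ^ ((2 - y) / 8)) ^ ν := by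
    intro p hp ν
    rw [tilt_prime_pow hGdef hp, tilt_prime hGdef hp]
    refine pow_le_pow_left₀ (by positivity) (mul_le_mul_of_nonneg_left ?_ hy0) ν
    have hp1 : (1 : ℝ) ≤ p := by exact_mod_cast hp.one_lt.le
    split_ifs
    · exact Real.rpow_le_rpow_of_exponent_le hp1 hσ₀
    · exact Real.one_le_rpow hp1 (by linarith)
  -- the prime sum: `G(p) ρ(p)/p ≤ y ρ(p)/p + 2yσ Cρ log p/p · [p ≤ z]`
  have hρp : ∀ p : ℕ, p.Prime → (polyRootCountMod ![f j] p : ℝ) ≤ Cρ := fun p hp => by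
    have h3 := hCρ p hp 1
    rw [pow_one] at h3
    have h2 : polyRootCountMod ![f j] p ≤ polyRootCountMod f p := by
      rw [polyRootCountMod_single]
      unfold polyRootCountMod
      refine Finset.card_le_card fun n hn => ?_
      rw [Finset.mem_filter] at hn ⊢
      exact ⟨hn.1, hn.2.trans (Finset.dvd_prod_of_mem (fun i => (f i).eval (n : ℤ)) (Finset.mem_univ j))⟩
    exact_mod_cast h2.trans h3
  have hsum : ∑ p ∈ Nat.primesLE N, G p * (polyRootCountMod ![f j] p : ℝ) / p ≤
      y * (∑ p ∈ Nat.primesLE N, (polyRootCountMod ![f j] p : ℝ) / p) + K := by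
    have h1 : ∀ p ∈ Nat.primesLE N, G p * (polyRootCountMod ![f j] p : ℝ) / p ≤
        y * ((polyRootCountMod ![f j] p : ℝ) / p) + (if (p : ℝ) ≤ z then 2 * y * σ * Cρ * (Real.log p / p) else 0) := by
      intro p hp
      have hp' := Nat.prime_of_mem_primesLE hp
      have hp0 : (0 : ℝ) < p := by exact_mod_cast hp'.pos
      have hρ0 : (0 : ℝ) ≤ polyRootCountMod ![f j] p := Nat.cast_nonneg _
      rw [tilt_prime hGdef hp']
      split_ifs with hpz
      · have h2 := rpow_le_one_add_of_le hp' hpz hσ hσz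
        have hlogp : 0 ≤ Real.log p := Real.log_nonneg (by exact_mod_cast hp'.one_lt.le)
        calc y * (p : ℝ) ^ σ * (polyRootCountMod ![f j] p : ℝ) / p
            ≤ y * (1 + 2 * σ * Real.log p) * (polyRootCountMod ![f j] p : ℝ) / p := by gcongr
          _ = y * ((polyRootCountMod ![f j] p : ℝ) / p) + 2 * y * σ * (polyRootCountMod ![f j] p : ℝ) * (Real.log p / p) := by
              ring
          _ ≤ y * ((polyRootCountMod ![f j] p : ℝ) / p) + 2 * y * σ * Cρ * (Real.log p / p) := by
              have := hρp p hp'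
              have h0 : 0 ≤ 2 * y * σ * (Real.log p / p) := by positivity
              nlinarith
      · rw [mul_one, add_zero, mul_div_assoc]
    refine (Finset.sum_le_sum h1).trans ?_
    rw [Finset.sum_add_distrib, ← Finset.mul_sum, ← Finset.sum_filter]
    refine add_le_add le_rfl ?_
    have hsub : (Nat.primesLE N).filter (fun p : ℕ => (p : ℝ) ≤ z) ⊆ Nat.primesLE ⌊z⌋₊ := by
      intro p hp
      rw [Finset.mem_filter, Nat.mem_primesLE] at hp
      exact Nat.mem_primesLE.mpr ⟨Nat.le_floor hp.2, hp.1.2⟩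
    calc ∑ p ∈ (Nat.primesLE N).filter (fun p : ℕ => (p : ℝ) ≤ z), 2 * y * σ * Cρ * (Real.log p / p)
        ≤ ∑ p ∈ Nat.primesLE ⌊z⌋₊, 2 * y * σ * Cρ * (Real.log p / p) :=
          Finset.sum_le_sum_of_subset_of_nonneg hsub fun p _ _ => by
            have : 0 ≤ Real.log (p : ℝ) / p := div_nonneg (Real.log_natCast_nonneg p) (Nat.cast_nonneg p)
            positivity
      _ = 2 * y * σ * Cρ * ∑ p ∈ Nat.primesLE ⌊z⌋₊, Real.log p / p := by rw [Finset.mul_sum]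
      _ ≤ 2 * y * σ * Cρ * (Real.log ⌊z⌋₊ + Real.log 4) :=
          mul_le_mul_of_nonneg_left (Literature.NumberTheory.LFunctions.MertensBound.sum_log_div_prime_le _) (by positivity)
      _ ≤ 2 * y * σ * Cρ * (Real.log z + Real.log 4) := by
          gcongr
          · exact_mod_cast Nat.floor_pos.mpr hz
          · exact Nat.floor_le (by linarith)
      _ ≤ K := by
          rw [hK]
          have hl4 : Real.log 4 ≤ 3 := by
            have := Real.log_le_sub_one_of_pos (show (0 : ℝ) < 4 by norm_num); linarith
          have hσ4 : σ * Real.log 4 ≤ 1 := by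
            calc σ * Real.log 4 ≤ ((2 - y) / 8) * 3 := mul_le_mul hσ₀ hl4 (Real.log_nonneg (by norm_num)) (by linarith)
              _ ≤ 1 := by linarith
          have e : 2 * y * σ * Cρ * (Real.log z + Real.log 4) = 2 * y * Cρ * (σ * Real.log z + σ * Real.log 4) := by ring
          rw [e]
          have hC0' : (0 : ℝ) ≤ 2 * y * Cρ := by positivity
          nlinarith
  have h := hC j G N N K hN (tilt_nonneg hGdef hy0) (tilt_one hGdef) (fun m n hmn => tilt_mul_of_coprime hGdef hmn) hGp hsum
  calc ∑ m ∈ Icc 1 N, y ^ cardFactors m * (smoothPart z m : ℝ) ^ σ * (polyRootCountMod ![f j] m : ℝ) / m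
      = ∑ m ∈ Icc 1 N, G m * (polyRootCountMod ![f j] m : ℝ) / m := Finset.sum_congr rfl fun m _ => by rw [hGdef]
    _ ≤ C * Real.exp K * Real.log N ^ y := h
    _ = C * Real.exp K * Real.log N ^ y := rfl

end

end Summit.Parity.BatemanHorn.Cruxes.LSDRealSegment.ProductAnatomySubcritical
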